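import Mathlib
import HarnessLib
import Summits.HubbardSuperconductivity.HubbardSuperconductivity.Theorems.KLProgrammeC4aTransversalityGaussLaw
import Summits.HubbardSuperconductivity.HubbardSuperconductivity.Theorems.KLProgrammeC4aLoopChordBounds
import Summits.HubbardSuperconductivity.HubbardSuperconductivity.Theorems.KLProgrammeC4aPartnerBandCrossings

/-!
# Route `KLProgramme` — crux C4a, S3 brick (B2-trans)(b) GEOMETRY, part 3: the DIRECT-SHEET ALIGNMENT DICHOTOMY on the co-moving pp loop —
# a small angular slope of the partner band at a loop point whose partner lies on the direct sheet forces EITHER the Cooper configuration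
# (`‖ϑ − π‖_𝕋` small) OR the chord-midpoint configuration (`(Φ(0,θ)+Φ(ρ,ϑ+θ))/2` close to the curve point `Φ(0,φ+θ)`), quantitatively

Cell `gate-hubbard-kl`, seat hubbard-kl-k3c3-p3 g19 (row «implicit-function / monotonicity route for μ(n)»); helper for stub (C) `stub_twoLeg_curvature` of
`KLRegimeEngineV17F2` (stmt-HubbardSuperconductivity-20437), lane hubbard-kl-c4a-1's S3 plan §24.10 (B2-trans)(b): «away from the crossings a global lower bound
on the loop circle … needs the convexity of FS»; this row's located note HOME/hubbard-kl-k3c3-p3/B2TRANS-UMKLAPP.md (why «direct sheet»: on klWindowC the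
partner `S − p` also reaches the umklapp sheets `FS + 2πG`, where the statement is false; here the partner is ASSUMED to be a chart point `Φ(e′,ψ)`).
SETTING (c4a-1's): `S = S_{ρ,ϑ,θ}(0) = Φ(0,θ) + Φ(ρ,ϑ+θ)` (`pairSumPath`), loop point `p = Φ(e, φ+θ)`, partner `S − p = Φ(e′, ψ)` (hypothesis `hP`),
crossing slope `ℓ = De_K(Φ(e′,ψ))[∂_sΦ(e,φ+θ)] = −∂_φ ē` (`deriv_partnerBand_pp_angle_eq_neg`).  RESULTS:
* §1 `min_le_iff_of_alignment` bookkeeping; **`loopAlignment_angle_le`** — `c_K·min(‖ψ − φ − θ‖_𝕋, ‖ψ − φ − θ − π‖_𝕋) ≤ (π/2)|ℓ|/((Dt−2A)u_min) + πKc|e′ − e|/(Dt−2A)²`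
  (part 2's Gauss law read as alignment: the partner's angle agrees with the loop angle mod π);
* §2 **`norm_pairSum_le_of_cooperBranch`** — if `‖ψ − φ − θ − π‖_𝕋 ≤ τ` then `‖S‖ ≤ msD·τ + |e − e′|/(Dt−2A)`, whence with part 1's Cooper chord
  **`torusDist_sub_pi_le_of_cooperBranch`**: `(2u_min/π)‖ϑ − π‖_𝕋 ≤ msD·τ + |e − e′|/(Dt−2A)`;
* §3 **`norm_pairSum_sub_two_le_of_tangencyBranch`** — if `‖ψ − φ − θ‖_𝕋 ≤ τ` then `‖S − 2Φ(0,φ+θ)‖ ≤ msD·τ + (|e| + |e′|)/(Dt−2A)` (the chord midpoint of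
  `[Φ(0,θ), Φ(ρ,ϑ+θ)]` is `½`-that close to the curve point `Φ(0,φ+θ)`);
* §4 **`loopAlignment_dichotomy`** — the two branches assembled: with `τ := ((π/2)|ℓ|/((Dt−2A)u_min) + πKc|e′−e|/(Dt−2A)²)/c_K`,
  `(2u_min/π)‖ϑ − π‖_𝕋 ≤ msD·τ + |e−e′|/(Dt−2A)  ∨  ‖S − 2Φ(0,φ+θ)‖ ≤ msD·τ + (|e|+|e′|)/(Dt−2A)` — i.e. a loop point with small `|∂_φē|` AND small partner level
  `|ē| = |e′|` is near-Cooper or near the chord-midpoint configuration; part 4 (midpoint depth) turns the second branch into `‖ϑ‖_𝕋² + ‖φ‖_𝕋² ≲ …`.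
Everything proved on landed objects in c4a-1's binder shape (+ `GeomConstants`, clause (i) of `FrameOK`); nothing about the model's sizes; nothing asserts superconductivity.
References: BGM 2003 §7.1 Lemma 7.1 (A1.9) [cite: BenfattoGiulianiMastropietro2003]; FST II CPAM 51 (1998) §3, App. B [cite: FeldmanSalmhoferTrubowitz1998];
BGM 2006 §2.4 (2.40), App. A2 [cite: BenfattoGiulianiMastropietro2006].
-/

noncomputable section

namespace Summit.HubbardSuperconductivity.HubbardSuperconductivity.Theorems.C4a

set_option linter.dupNamespace false -- summit = problem name (single-conjunct summit), D-0017

open Real Set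
open Literature.MathematicalPhysics.QuantumLattice Literature.MathematicalPhysics.QuantumLattice.BandSectorCounting
open Literature.MathematicalPhysics.QuantumLattice.FermiRG
open Summit.HubbardSuperconductivity.HubbardSuperconductivity.Theorems.KLRegimeSplit
open Summit.HubbardSuperconductivity.HubbardSuperconductivity.Theorems.DispersionFlow
open Summit.HubbardSuperconductivity.HubbardSuperconductivity.Theorems.PerturbedFermiCurve

section Sizes

variable {K : TrigPolyC4v} {A : ℝ} (hA : ∀ p : Momentum, ∀ j ≤ 2, ‖iteratedFDeriv ℝ j (frameShift K) p‖ ≤ A) (hA20 : A ≤ 1 / 20)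
  (hd : klCurveD ≤ (bandBounds (show (-4 : ℝ) < -1.1 by norm_num) (show (-1.1 : ℝ) ≤ -0.1 by norm_num)
    (show (-0.1 : ℝ) < 0 by norm_num)).Dtmin - 2 * A)
  {μ r : ℝ} (hr : 0 < r) (hlo : (-1.1 : ℝ) < μ - r - A) (hhi : μ + r + A < -0.1)
  {A₃ A₄ : ℝ} (hA₃ : ∀ p : Momentum, ‖iteratedFDeriv ℝ 3 (frameShift K) p‖ ≤ A₃)
  (hA₄ : ∀ p : Momentum, ‖iteratedFDeriv ℝ 4 (frameShift K) p‖ ≤ A₄)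
include hA hA20 hd hr hlo hhi hA₃ hA₄

/-! ## §1 The slope at a loop point with partner on the direct sheet, and the alignment it forces -/

omit hA20 hr hA₃ hA₄ in
/-- **The angular slope of the partner band in terms of the partner's chart point**: if `S − Φ(e,φ+θ) = Φ(e′,ψ)` then
`∂_φ e_K(S − Φ(e,·+θ))|_φ = −De_K(Φ(e′,ψ))[∂_sΦ(e,φ+θ)]`. -/
theorem deriv_partnerBand_pp_angle_eq_neg {ρ e e' : ℝ} (he : |e| < r) {ϑ θ φ ψ : ℝ}
    (hP : pairSumPath μ K ρ ϑ θ 0 - levelPoint μ K e (φ + θ) = levelPoint μ K e' ψ) :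
    deriv (fun x : ℝ => frameLevel μ K (pairSumPath μ K ρ ϑ θ 0 - levelPoint μ K e (x + θ))) φ =
      -fderiv ℝ (frameLevel μ K) (levelPoint μ K e' ψ) (iteratedDeriv 1 (levelPoint μ K e) (φ + θ)) := by
  rw [(hasDerivAt_partnerBand_pp_angle hA hd hlo hhi (ρ := ρ) he ϑ θ φ).deriv, hP]

omit hA20 hr hA₃ hA₄ in
/-- **ALIGNMENT**: under `GeomConstants (frameLevel μ K) Kc r₀ g₀ w`, if the partner of the loop point `Φ(e,φ+θ)` (`|e| < r₀`) is the chart point `Φ(e′,ψ)`, then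
`c_K·min(‖ψ − (φ+θ)‖_𝕋, ‖ψ − (φ+θ) − π‖_𝕋) ≤ (π/2)|ℓ|/((Dt−2A)u_min) + π·Kc·|e′ − e|/(Dt−2A)²`, `ℓ = De_K(Φ(e′,ψ))[∂_sΦ(e,φ+θ)]`, `c_K = u_min·w/(4+2A)`:
the partner's angle agrees with the loop angle mod `π` up to the slope and the level gap. [cite: BenfattoGiulianiMastropietro2003, §7.1 Lemma 7.1 (A1.9)] -/
theorem loopAlignment_angle_le {Kc r₀ g₀ w : ℝ} (hG : GeomConstants (frameLevel μ K) Kc r₀ g₀ w) {e e' : ℝ} (he : |e| < r) (he' : |e'| < r)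
    (he₀ : |e| < r₀) (φ θ ψ : ℝ) :
    (bandBounds (show (-4 : ℝ) < -1.1 by norm_num) (show (-1.1 : ℝ) ≤ -0.1 by norm_num) (show (-0.1 : ℝ) < 0 by norm_num)).umin * w / (4 + 2 * A) *
        min (torusDist (ψ - (φ + θ))) (torusDist (ψ - (φ + θ) - π)) ≤
      π / 2 * |fderiv ℝ (frameLevel μ K) (levelPoint μ K e' ψ) (iteratedDeriv 1 (levelPoint μ K e) (φ + θ))| /
          (((bandBounds (show (-4 : ℝ) < -1.1 by norm_num) (show (-1.1 : ℝ) ≤ -0.1 by norm_num) (show (-0.1 : ℝ) < 0 by norm_num)).Dtmin - 2 * A) *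
            (bandBounds (show (-4 : ℝ) < -1.1 by norm_num) (show (-1.1 : ℝ) ≤ -0.1 by norm_num) (show (-0.1 : ℝ) < 0 by norm_num)).umin) +
        π * Kc * |e' - e| / ((bandBounds (show (-4 : ℝ) < -1.1 by norm_num) (show (-1.1 : ℝ) ≤ -0.1 by norm_num)
          (show (-0.1 : ℝ) < 0 by norm_num)).Dtmin - 2 * A) ^ 2 := by
  set B := bandBounds (show (-4 : ℝ) < -1.1 by norm_num) (show (-1.1 : ℝ) ≤ -0.1 by norm_num) (show (-0.1 : ℝ) < 0 by norm_num) with hBdef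
  have hADt : 2 * A < B.Dtmin := by have := klCurveD_pos; linarith
  have hD : 0 < (B.Dtmin - 2 * A) * B.umin := mul_pos (by linarith) B.umin_pos
  have hπ := Real.pi_pos
  have h := abs_fderiv_frameLevel_levelPoint_tangent_ge hA hd hlo hhi hG he' he he₀ ψ (φ + θ)
  set ℓ := fderiv ℝ (frameLevel μ K) (levelPoint μ K e' ψ) (iteratedDeriv 1 (levelPoint μ K e) (φ + θ)) with hℓ
  set X := B.umin * w / (4 + 2 * A) * min (torusDist (ψ - (φ + θ))) (torusDist (ψ - (φ + θ) - π)) -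
      π * Kc * |e' - e| / (B.Dtmin - 2 * A) ^ 2 with hX
  -- `h : (2/π)·D·X ≤ |ℓ|`; hence `X ≤ (π/2)|ℓ|/D`
  have h1 : (B.Dtmin - 2 * A) * B.umin * X ≤ π / 2 * |ℓ| := by
    have e1 : (B.Dtmin - 2 * A) * B.umin * X = π / 2 * (2 / π * ((B.Dtmin - 2 * A) * B.umin) * X) := by field_simp
    rw [e1]; exact mul_le_mul_of_nonneg_left h (by positivity)
  have h2 : X ≤ π / 2 * |ℓ| / ((B.Dtmin - 2 * A) * B.umin) := by
    rw [le_div_iff₀ hD]; linarith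
  linarith

/-! ## §2 The Cooper branch: the partner angle is antipodal to the loop angle -/

omit hA hA20 hd hr hlo hhi hA₃ hA₄ in
/-- The pair sum in terms of the loop point and its partner: `S = Φ(e,φ+θ) + Φ(e′,ψ)`. -/
theorem pairSum_eq_add_of_partner {ρ e e' : ℝ} {ϑ θ φ ψ : ℝ} (hP : pairSumPath μ K ρ ϑ θ 0 - levelPoint μ K e (φ + θ) = levelPoint μ K e' ψ) :
    pairSumPath μ K ρ ϑ θ 0 = levelPoint μ K e (φ + θ) + levelPoint μ K e' ψ := by
  rw [← hP]; abel

omit hr in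
/-- **Cooper branch, size of `S`**: if the partner angle is within `τ` of the ANTIPODE of the loop angle, `‖ψ − (φ+θ) − π‖_𝕋 ≤ τ`, then
`‖S‖ ≤ msD A₃ A₄ 1·τ + |e − e′|/(Dt−2A)`. -/
theorem norm_pairSum_le_of_cooperBranch {ρ e e' : ℝ} (he : |e| < r) (he' : |e'| < r) {ϑ θ φ ψ τ : ℝ}
    (hP : pairSumPath μ K ρ ϑ θ 0 - levelPoint μ K e (φ + θ) = levelPoint μ K e' ψ) (hτ : torusDist (ψ - (φ + θ) - π) ≤ τ) :
    ‖pairSumPath μ K ρ ϑ θ 0‖ ≤ msD A₃ A₄ 1 * τ +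
      |e - e'| / ((bandBounds (show (-4 : ℝ) < -1.1 by norm_num) (show (-1.1 : ℝ) ≤ -0.1 by norm_num) (show (-0.1 : ℝ) < 0 by norm_num)).Dtmin - 2 * A) := by
  set B := bandBounds (show (-4 : ℝ) < -1.1 by norm_num) (show (-1.1 : ℝ) ≤ -0.1 by norm_num) (show (-0.1 : ℝ) < 0 by norm_num) with hBdef
  have hADt : 2 * A < B.Dtmin := by have := klCurveD_pos; linarith
  have heI : e ∈ Ioo (-r) r := ⟨(abs_lt.1 he).1, (abs_lt.1 he).2⟩
  have heI' : e' ∈ Ioo (-r) r := ⟨(abs_lt.1 he').1, (abs_lt.1 he').2⟩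
  rw [pairSum_eq_add_of_partner hP]
  -- `Φ(e′,ψ) = (Φ(e′,ψ) − Φ(e′,φ+θ+π)) − Φ(e′,φ+θ)` and `Φ(e,φ+θ) − Φ(e′,φ+θ)` is radial
  have hsplit : levelPoint μ K e (φ + θ) + levelPoint μ K e' ψ =
      (levelPoint μ K e' ψ - levelPoint μ K e' (φ + θ + π)) + (levelPoint μ K e (φ + θ) - levelPoint μ K e' (φ + θ)) := by
    rw [levelPoint_add_pi]; abel
  rw [hsplit]
  have h1 : ‖levelPoint μ K e' ψ - levelPoint μ K e' (φ + θ + π)‖ ≤ msD A₃ A₄ 1 * τ := by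
    refine (norm_levelPoint_sub_le_torusDist hA hA20 hd hlo hhi hA₃ hA₄ he' ψ (φ + θ + π)).trans ?_
    have hD0 : 0 ≤ msD A₃ A₄ 1 := (norm_nonneg _).trans (norm_iteratedDeriv_levelPoint_le hA hA20 hd hlo hhi hA₃ hA₄ he le_rfl (by norm_num) 0)
    rw [show ψ - (φ + θ + π) = ψ - (φ + θ) - π by ring]
    exact mul_le_mul_of_nonneg_left hτ hD0
  have h2 : ‖levelPoint μ K e (φ + θ) - levelPoint μ K e' (φ + θ)‖ ≤ |e - e'| / (B.Dtmin - 2 * A) :=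
    norm_levelPoint_sub_levelPoint_le B hA hADt hlo hhi heI heI' (φ + θ)
  exact (norm_add_le _ _).trans (add_le_add h1 h2)

/-- **Cooper branch, conclusion**: `(2u_min/π)·‖ϑ − π‖_𝕋 ≤ msD A₃ A₄ 1·τ + |e − e′|/(Dt−2A)` (part 1's lower chord bound for `S = Φ(0,θ) + Φ(ρ,ϑ+θ)`).
[cite: BenfattoGiulianiMastropietro2003, §7.1 Lemma 7.1] -/
theorem torusDist_sub_pi_le_of_cooperBranch {ρ e e' : ℝ} (hρ : |ρ| < r) (he : |e| < r) (he' : |e'| < r) {ϑ θ φ ψ τ : ℝ}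
    (hP : pairSumPath μ K ρ ϑ θ 0 - levelPoint μ K e (φ + θ) = levelPoint μ K e' ψ) (hτ : torusDist (ψ - (φ + θ) - π) ≤ τ) :
    2 * (bandBounds (show (-4 : ℝ) < -1.1 by norm_num) (show (-1.1 : ℝ) ≤ -0.1 by norm_num) (show (-0.1 : ℝ) < 0 by norm_num)).umin / π *
        torusDist (ϑ - π) ≤
      msD A₃ A₄ 1 * τ +
        |e - e'| / ((bandBounds (show (-4 : ℝ) < -1.1 by norm_num) (show (-1.1 : ℝ) ≤ -0.1 by norm_num) (show (-0.1 : ℝ) < 0 by norm_num)).Dtmin - 2 * A) := by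
  set B := bandBounds (show (-4 : ℝ) < -1.1 by norm_num) (show (-1.1 : ℝ) ≤ -0.1 by norm_num) (show (-0.1 : ℝ) < 0 by norm_num) with hBdef
  have h0 : |(0 : ℝ)| < r := by simpa using hr
  have hlo₀ : (-1.1 : ℝ) ≤ μ + 0 - A := by linarith
  have hhi₀ : μ + 0 + A ≤ -0.1 := by linarith
  have hloρ : (-1.1 : ℝ) ≤ μ + ρ - A := by have := (abs_lt.1 hρ).1; linarith
  have hhiρ : μ + ρ + A ≤ -0.1 := by have := (abs_lt.1 hρ).2; linarith
  have hch := norm_levelPoint_add_ge_torusDist B hA hlo₀ hhi₀ hloρ hhiρ θ (ϑ + θ)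
  have e0 : θ - (ϑ + θ) - π = -(ϑ + π) := by ring
  have eπ : ϑ + π = ϑ - π + ((1 : ℤ) : ℝ) * (2 * π) := by push_cast; ring
  have e1 : torusDist (θ - (ϑ + θ) - π) = torusDist (ϑ - π) := by
    rw [e0, torusDist_neg', eπ, torusDist_add_int_mul_two_pi]
  have hS : pairSumPath μ K ρ ϑ θ 0 = levelPoint μ K 0 θ + levelPoint μ K ρ (ϑ + θ) := by
    simp only [pairSumPath, add_zero]
  have hup := norm_pairSum_le_of_cooperBranch hA hA20 hd hlo hhi hA₃ hA₄ he he' hP hτ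
  rw [hS] at hup
  rw [e1] at hch
  exact hch.trans hup

/-! ## §3 The tangency branch: the partner angle equals the loop angle; the chord midpoint is near the curve -/

omit hr in
/-- **Tangency branch**: if the partner angle is within `τ` of the loop angle, `‖ψ − (φ+θ)‖_𝕋 ≤ τ`, then
`‖S − 2Φ(0,φ+θ)‖ ≤ msD A₃ A₄ 1·τ + (|e| + |e′|)/(Dt−2A)` — the midpoint of the chord `[Φ(0,θ), Φ(ρ,ϑ+θ)]` is within half of that of the curve point
`Φ(0, φ+θ)`. [cite: FeldmanSalmhoferTrubowitz1998, §3] -/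
theorem norm_pairSum_sub_two_le_of_tangencyBranch {ρ e e' : ℝ} (he : |e| < r) (he' : |e'| < r) {ϑ θ φ ψ τ : ℝ}
    (hP : pairSumPath μ K ρ ϑ θ 0 - levelPoint μ K e (φ + θ) = levelPoint μ K e' ψ) (hτ : torusDist (ψ - (φ + θ)) ≤ τ) :
    ‖pairSumPath μ K ρ ϑ θ 0 - (2 : ℝ) • levelPoint μ K 0 (φ + θ)‖ ≤ msD A₃ A₄ 1 * τ +
      (|e| + |e'|) / ((bandBounds (show (-4 : ℝ) < -1.1 by norm_num) (show (-1.1 : ℝ) ≤ -0.1 by norm_num) (show (-0.1 : ℝ) < 0 by norm_num)).Dtmin - 2 * A) := by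
  set B := bandBounds (show (-4 : ℝ) < -1.1 by norm_num) (show (-1.1 : ℝ) ≤ -0.1 by norm_num) (show (-0.1 : ℝ) < 0 by norm_num) with hBdef
  have hADt : 2 * A < B.Dtmin := by have := klCurveD_pos; linarith
  have hden : 0 < B.Dtmin - 2 * A := by linarith
  have h0 : |(0 : ℝ)| < r := lt_of_le_of_lt (by simp) (lt_of_le_of_lt (abs_nonneg e) he)
  have heI : e ∈ Ioo (-r) r := ⟨(abs_lt.1 he).1, (abs_lt.1 he).2⟩
  have heI' : e' ∈ Ioo (-r) r := ⟨(abs_lt.1 he').1, (abs_lt.1 he').2⟩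
  have h0I : (0 : ℝ) ∈ Ioo (-r) r := ⟨by linarith [(abs_lt.1 he).1, (abs_lt.1 he).2], lt_of_le_of_lt (abs_nonneg e) he⟩
  rw [pairSum_eq_add_of_partner hP]
  have hsplit : levelPoint μ K e (φ + θ) + levelPoint μ K e' ψ - (2 : ℝ) • levelPoint μ K 0 (φ + θ) =
      (levelPoint μ K e (φ + θ) - levelPoint μ K 0 (φ + θ)) + (levelPoint μ K e' ψ - levelPoint μ K e' (φ + θ)) +
        (levelPoint μ K e' (φ + θ) - levelPoint μ K 0 (φ + θ)) := by
    rw [two_smul]; abel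
  rw [hsplit]
  have h1 : ‖levelPoint μ K e (φ + θ) - levelPoint μ K 0 (φ + θ)‖ ≤ |e| / (B.Dtmin - 2 * A) := by
    simpa using norm_levelPoint_sub_levelPoint_le B hA hADt hlo hhi heI h0I (φ + θ)
  have h2 : ‖levelPoint μ K e' ψ - levelPoint μ K e' (φ + θ)‖ ≤ msD A₃ A₄ 1 * τ := by
    refine (norm_levelPoint_sub_le_torusDist hA hA20 hd hlo hhi hA₃ hA₄ he' ψ (φ + θ)).trans ?_
    have hD0 : 0 ≤ msD A₃ A₄ 1 := (norm_nonneg _).trans (norm_iteratedDeriv_levelPoint_le hA hA20 hd hlo hhi hA₃ hA₄ he le_rfl (by norm_num) 0)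
    exact mul_le_mul_of_nonneg_left hτ hD0
  have h3 : ‖levelPoint μ K e' (φ + θ) - levelPoint μ K 0 (φ + θ)‖ ≤ |e'| / (B.Dtmin - 2 * A) := by
    simpa using norm_levelPoint_sub_levelPoint_le B hA hADt hlo hhi heI' h0I (φ + θ)
  calc _ ≤ ‖levelPoint μ K e (φ + θ) - levelPoint μ K 0 (φ + θ)‖ + ‖levelPoint μ K e' ψ - levelPoint μ K e' (φ + θ)‖ +
        ‖levelPoint μ K e' (φ + θ) - levelPoint μ K 0 (φ + θ)‖ := norm_add₃_le
    _ ≤ |e| / (B.Dtmin - 2 * A) + msD A₃ A₄ 1 * τ + |e'| / (B.Dtmin - 2 * A) := add_le_add (add_le_add h1 h2) h3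
    _ = msD A₃ A₄ 1 * τ + (|e| + |e'|) / (B.Dtmin - 2 * A) := by rw [add_div]; ring

/-! ## §4 The dichotomy -/

/-- **THE DIRECT-SHEET ALIGNMENT DICHOTOMY.**  Under clause (i) of `FrameOK` (`GeomConstants (frameLevel μ K) Kc r₀ g₀ w`), for the co-moving pp loop with
`S = Φ(0,θ) + Φ(ρ,ϑ+θ)`, loop point `Φ(e, φ+θ)` (`|e| < r`, `|e| < r₀`) whose partner is the DIRECT-SHEET chart point `Φ(e′,ψ)` (`|e′| < r`), writing
`ℓ = De_K(Φ(e′,ψ))[∂_sΦ(e,φ+θ)] = −∂_φē` and `τ = ((π/2)|ℓ|/((Dt−2A)u_min) + πKc|e′ − e|/(Dt−2A)²)/c_K` (`c_K = u_min·w/(4+2A)`): EITHER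
`(2u_min/π)·‖ϑ − π‖_𝕋 ≤ msD·τ + |e − e′|/(Dt−2A)` (COOPER) OR `‖S − 2Φ(0,φ+θ)‖ ≤ msD·τ + (|e| + |e′|)/(Dt−2A)` (chord-midpoint near the curve: TANGENCY corner).
Contrapositive = the «|ē| + |∂_φē| ≥ c(δ)» non-degeneracy of (B2-trans)(b) on the direct sheet, with part 4's midpoint depth for the second branch.
[cite: BenfattoGiulianiMastropietro2003, §7.1 Lemma 7.1 (A1.9)] -/
theorem loopAlignment_dichotomy {Kc r₀ g₀ w : ℝ} (hG : GeomConstants (frameLevel μ K) Kc r₀ g₀ w) {ρ e e' : ℝ} (hρ : |ρ| < r) (he : |e| < r)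
    (he' : |e'| < r) (he₀ : |e| < r₀) {ϑ θ φ ψ : ℝ} (hP : pairSumPath μ K ρ ϑ θ 0 - levelPoint μ K e (φ + θ) = levelPoint μ K e' ψ) :
    2 * (bandBounds (show (-4 : ℝ) < -1.1 by norm_num) (show (-1.1 : ℝ) ≤ -0.1 by norm_num) (show (-0.1 : ℝ) < 0 by norm_num)).umin / π *
          torusDist (ϑ - π) ≤
        msD A₃ A₄ 1 *
            ((π / 2 * |fderiv ℝ (frameLevel μ K) (levelPoint μ K e' ψ) (iteratedDeriv 1 (levelPoint μ K e) (φ + θ))| /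
                  (((bandBounds (show (-4 : ℝ) < -1.1 by norm_num) (show (-1.1 : ℝ) ≤ -0.1 by norm_num) (show (-0.1 : ℝ) < 0 by norm_num)).Dtmin -
                      2 * A) *
                    (bandBounds (show (-4 : ℝ) < -1.1 by norm_num) (show (-1.1 : ℝ) ≤ -0.1 by norm_num) (show (-0.1 : ℝ) < 0 by norm_num)).umin) +
                π * Kc * |e' - e| / ((bandBounds (show (-4 : ℝ) < -1.1 by norm_num) (show (-1.1 : ℝ) ≤ -0.1 by norm_num)
                  (show (-0.1 : ℝ) < 0 by norm_num)).Dtmin - 2 * A) ^ 2) /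
              ((bandBounds (show (-4 : ℝ) < -1.1 by norm_num) (show (-1.1 : ℝ) ≤ -0.1 by norm_num) (show (-0.1 : ℝ) < 0 by norm_num)).umin * w /
                (4 + 2 * A))) +
          |e - e'| / ((bandBounds (show (-4 : ℝ) < -1.1 by norm_num) (show (-1.1 : ℝ) ≤ -0.1 by norm_num) (show (-0.1 : ℝ) < 0 by norm_num)).Dtmin - 2 * A) ∨
      ‖pairSumPath μ K ρ ϑ θ 0 - (2 : ℝ) • levelPoint μ K 0 (φ + θ)‖ ≤
        msD A₃ A₄ 1 *
            ((π / 2 * |fderiv ℝ (frameLevel μ K) (levelPoint μ K e' ψ) (iteratedDeriv 1 (levelPoint μ K e) (φ + θ))| /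
                  (((bandBounds (show (-4 : ℝ) < -1.1 by norm_num) (show (-1.1 : ℝ) ≤ -0.1 by norm_num) (show (-0.1 : ℝ) < 0 by norm_num)).Dtmin -
                      2 * A) *
                    (bandBounds (show (-4 : ℝ) < -1.1 by norm_num) (show (-1.1 : ℝ) ≤ -0.1 by norm_num) (show (-0.1 : ℝ) < 0 by norm_num)).umin) +
                π * Kc * |e' - e| / ((bandBounds (show (-4 : ℝ) < -1.1 by norm_num) (show (-1.1 : ℝ) ≤ -0.1 by norm_num)
                  (show (-0.1 : ℝ) < 0 by norm_num)).Dtmin - 2 * A) ^ 2) /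
              ((bandBounds (show (-4 : ℝ) < -1.1 by norm_num) (show (-1.1 : ℝ) ≤ -0.1 by norm_num) (show (-0.1 : ℝ) < 0 by norm_num)).umin * w /
                (4 + 2 * A))) +
          (|e| + |e'|) / ((bandBounds (show (-4 : ℝ) < -1.1 by norm_num) (show (-1.1 : ℝ) ≤ -0.1 by norm_num) (show (-0.1 : ℝ) < 0 by norm_num)).Dtmin - 2 * A) := by
  set B := bandBounds (show (-4 : ℝ) < -1.1 by norm_num) (show (-1.1 : ℝ) ≤ -0.1 by norm_num) (show (-0.1 : ℝ) < 0 by norm_num) with hBdef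
  have hA0 : 0 ≤ A := (norm_nonneg _).trans (hA 0 0 (by norm_num))
  have hcK : 0 < B.umin * w / (4 + 2 * A) := by have := B.umin_pos; have := hG.wmin_pos; positivity
  set τ := (π / 2 * |fderiv ℝ (frameLevel μ K) (levelPoint μ K e' ψ) (iteratedDeriv 1 (levelPoint μ K e) (φ + θ))| /
        ((B.Dtmin - 2 * A) * B.umin) + π * Kc * |e' - e| / (B.Dtmin - 2 * A) ^ 2) / (B.umin * w / (4 + 2 * A)) with hτdef
  have hal := loopAlignment_angle_le hA hd hlo hhi hG he he' he₀ φ θ ψ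
  have hmin : min (torusDist (ψ - (φ + θ))) (torusDist (ψ - (φ + θ) - π)) ≤ τ := by
    rw [hτdef, le_div_iff₀ hcK, mul_comm]; exact hal
  rcases min_le_iff.1 hmin with h | h
  · exact Or.inr (norm_pairSum_sub_two_le_of_tangencyBranch hA hA20 hd hlo hhi hA₃ hA₄ he he' hP h)
  · exact Or.inl (torusDist_sub_pi_le_of_cooperBranch hA hA20 hd hr hlo hhi hA₃ hA₄ hρ he he' hP h)

end Sizes

end Summit.HubbardSuperconductivity.HubbardSuperconductivity.Theorems.C4a

end
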